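import Mathlib
import HarnessLib
import Literature.MathematicalPhysics.KineticTheory.HardSphereEuler
import Literature.MathematicalPhysics.KineticTheory.BackwardCluster
import Literature.MathematicalPhysics.KineticTheory.HardSphereDisplacementPathLength
import Summits.AtomisticToContinuum.HydrodynamicLimit.Theorems.RelayRaceLocalityGibbsLightConeLinkGlue
import Summits.AtomisticToContinuum.HydrodynamicLimit.Theorems.RelayRaceLocalityGibbsLightConeHotGlue

/-!
# Glue `H″` of the line `Sketch` for the crux `RelayRaceLocality.GibbsLightCone`
(stmt-AtomisticToContinuum-12501): the tilted slab-contact necklace bound implies the hot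
path-length tail

Helper file (`--supports stmt-AtomisticToContinuum-12501`). The registered stub
`stub_hotPathLengthTail_of_tiltedSlabContactNecklaceBound` (GLUE H″, skeleton revision 10) reduces
the HOT PATH-LENGTH TAIL (the hot path length — speed above `A√θ` only — of the carriers of some
simple collision chain into the tagged particle over the window `[0, M τ_N]` exceeds `λ M ℓ_N` with
probability `≤ C e^{-cM}`) to the TILTED SLAB-CONTACT NECKLACE BOUND `Y″` (for an injective label
sequence `q 0 … q n`, nondecreasing slab times `T 1 ≤ … ≤ T n` in the window and a slab width
`Δ ≤ ε_N/√θ`, the Gibbs probability that EVERY consecutive pair `q m, q (m+1)` is in contact at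
SOME time of its slab `[T (m+1), T (m+1) + Δ]` AND the hot path length of the carriers `q m` over
`[T m, T (m+1) + Δ]` exceeds `y ℓ_N` is `≤ C₂ (C₁ (ε_N + Λ√θΔ)³)ⁿ e^{c₂ M} e^{-η y}`). It is the
glue `H` of revision 8 (`stub_hotPathLengthTail_of_tiltedSpaceTimeNecklaceBound`, `…HotGlue.lean`)
with a simpler slabbing step:

* SLABBING (`exists_slabMap_necklace_sandwich_of_chain`, `…HotGlue.lean`): a chain with link times
  `T 1 ≤ … ≤ T n` in `[0, W]` has, at mesh `Δ`, nondecreasing slab times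
  `T' (m+1) = ⌊T (m+1)/Δ⌋ Δ` with the SANDWICH `T' j ≤ T j ≤ T' j + Δ`, so the true link time
  `T (m+1)` itself witnesses a contact of `q m, q (m+1)` during the slab `[T' (m+1), T' (m+1) + Δ]`,
  and the chain's hot path length over the carrying intervals `[T m, T (m+1)]` is at most the
  necklace functional over `[T' m, T' (m+1) + Δ]` (`integral_hot_mono_interval`); the slab map
  `m ↦ ⌊T (m+1)/Δ⌋ ∈ {0, …, ⌊W/Δ⌋}` is monotone;
* COUNTING (`card_filter_monotone_le_choose`) and ARITHMETIC (`choose_mul_pow_le_exp_mul_pow`) as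
  in glue `H`: mesh `Δ = ε_N/(Λ√θ)` (so `ε_N + Λ√θΔ = 2ε_N`, `W/Δ = ΛM/σ³`), union over the number
  of links `k`, the `≤ (N+1)ᵏ` injective label sequences ending at `p` and the `≤ C(m+k, k)`
  monotone slab maps (`m = ⌊ΛM/σ³⌋`), `(N+1) ε_N³ = σ³` (`succ_mul_hsDiameter_pow_three`), the
  bad set is null:
  `G(hot) ≤ Σ_k C(m+k,k) (8C₁σ³)ᵏ C₂ e^{c₂M - ηλM} ≤ 4 C₂ e^{16C₁ΛM + c₂M - ηλM} ≤ 4 C₂ e^{-M}`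
  (`ηλ = |c₂| + 16 C₁ Λ + 1`; `C₁`, `C₂` standing for `|C₁| + 1`, `|C₂|`), once `32 C₁ σ³ ≤ 1`.

All constants are fixed before `σ`. `Y″` itself is NOT proved here (the open seam of the line).
-/

namespace Summit.AtomisticToContinuum.HydrodynamicLimit.Theorems.LogWindowTaggedTail

open Literature.MathematicalPhysics.KineticTheory Literature.Analysis.FluidPDE MeasureTheory Filter Set

open scoped ENNReal

/-- **GLUE H″** (registered stub of the line `Sketch`, skeleton revision 10): the tilted
slab-contact necklace bound `Y″` implies the registered hot path-length tail — slabbing at mesh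
`Δ = ε_N/(Λ√θ)` with the sandwich (`exists_slabMap_necklace_sandwich_of_chain`: the slab of a link
time contains the link time, which witnesses the contact; `integral_hot_mono_interval`), union over
the number of links `k`, the `≤ (N+1)ᵏ` injective label sequences ending at the tagged particle and
the `≤ C(m+k, k)` monotone slab maps (`m = ⌊ΛM/σ³⌋`), `(N+1) ε_N³ = σ³`, the null bad set,
`C(m+k,k) (8C₁σ³)ᵏ ≤ e^{16C₁ΛM} (3/4)ᵏ` (`choose_mul_pow_le_exp_mul_pow`), `Σ_k (3/4)ᵏ = 4`;
`λ = (|c₂| + 16 C₁ Λ + 1)/η`, `c = 1`, `C = 4 |C₂|`. [folklore] -/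
theorem stub_hotPathLengthTail_of_tiltedSlabContactNecklaceBound :
    (∀ a θ : ℝ, 0 < a → 0 < θ → ∃ σ₀ : ℝ, 0 < σ₀ ∧ ∃ A η C₁ Λ c₂ C₂ : ℝ, 0 ≤ A ∧ 0 < η ∧ 1 ≤ Λ ∧
        ∀ K : ℝ, 0 < K →
        ∀ σ : ℝ, 0 < σ → σ < σ₀ →
        ∀ Φ : (N : ℕ) → HardSphereFlow (Torus.geometry (Fin 3)) (hsDiameter σ N) (N + 1),
        ∀ᶠ N : ℕ in atTop, ∀ M : ℝ, 1 ≤ M → M ≤ K * Real.log ((N : ℝ) + 2) →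
          ∀ Δ : ℝ, 0 < Δ → Δ ≤ hsDiameter σ N / Real.sqrt θ →
          ∀ (n : ℕ) (q : Fin (n + 1) → Fin (N + 1)) (T : Fin (n + 2) → ℝ),
            Function.Injective q → Monotone T → T 0 = 0 →
            T (Fin.last (n + 1)) = M * (((N + 1 : ℕ) : ℝ) ^ (-(1 / 3 : ℝ)) / σ ^ 2 / Real.sqrt θ) →
          ∀ y : ℝ, 0 ≤ y →
          localGibbsLaw σ (fun _ => a) (fun _ => 0) (fun _ => θ) N (Φ N)
            {z | (∀ m : Fin n, ∃ u ∈ Set.Icc (T (Fin.castSucc (Fin.succ m))) (T (Fin.castSucc (Fin.succ m)) + Δ),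
                s(q (Fin.castSucc m), q (Fin.succ m)) ∈
                  contactPairSet (Torus.geometry (Fin 3)) (hsDiameter σ N) ((Φ N).flow u z)) ∧
                y * (((N + 1 : ℕ) : ℝ) ^ (-(1 / 3 : ℝ)) / σ ^ 2) <
                  ∑ m : Fin (n + 1), ∫ u in T (Fin.castSucc m)..(T (Fin.succ m) + Δ),
                    (if A * Real.sqrt θ < ‖(((Φ N).flow u z) (q m)).2‖ then
                      ‖(((Φ N).flow u z) (q m)).2‖ else 0)}
            ≤ ENNReal.ofReal (C₂ * (C₁ * (hsDiameter σ N + Λ * Real.sqrt θ * Δ) ^ 3) ^ n *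
                Real.exp (c₂ * M) * Real.exp (-η * y))) →
    ∀ a θ : ℝ, 0 < a → 0 < θ → ∃ σ₀ : ℝ, 0 < σ₀ ∧ ∃ A lam c C : ℝ, 0 ≤ A ∧ 0 < c ∧ ∀ K : ℝ, 0 < K →
      ∀ σ : ℝ, 0 < σ → σ < σ₀ →
      ∀ Φ : (N : ℕ) → HardSphereFlow (Torus.geometry (Fin 3)) (hsDiameter σ N) (N + 1),
      ∀ᶠ N in atTop, ∀ p : Fin (N + 1), ∀ M : ℝ, 1 ≤ M → M ≤ K * Real.log ((N : ℝ) + 2) →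
        localGibbsLaw σ (fun _ => a) (fun _ => 0) (fun _ => θ) N (Φ N)
          {z | ∃ (k : ℕ) (q : Fin (k + 1) → Fin (N + 1)) (T : Fin (k + 2) → ℝ),
              q (Fin.last k) = p ∧ Function.Injective q ∧ Monotone T ∧
              StrictMono (fun m : Fin k => T (Fin.castSucc (Fin.succ m))) ∧ T 0 = 0 ∧
              T (Fin.last (k + 1)) = M * (((N + 1 : ℕ) : ℝ) ^ (-(1 / 3 : ℝ)) / σ ^ 2 / Real.sqrt θ) ∧
              (∀ m : Fin k, s(q (Fin.castSucc m), q (Fin.succ m)) ∈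
                contactPairSet (Torus.geometry (Fin 3)) (hsDiameter σ N)
                  ((Φ N).flow (T (Fin.castSucc (Fin.succ m))) z)) ∧
              lam * M * (((N + 1 : ℕ) : ℝ) ^ (-(1 / 3 : ℝ)) / σ ^ 2) <
                ∑ m : Fin (k + 1), ∫ u in T (Fin.castSucc m)..T (Fin.succ m),
                  (if A * Real.sqrt θ < ‖(((Φ N).flow u z) (q m)).2‖ then
                    ‖(((Φ N).flow u z) (q m)).2‖ else 0)}
          ≤ ENNReal.ofReal (C * Real.exp (-c * M)) := by
  -- adapted from `stub_hotPathLengthTail_of_tiltedSpaceTimeNecklaceBound` (glue `H`,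
  -- `…HotGlue.lean`)
  intro hY a θ ha hθ
  obtain ⟨σ₁, hσ₁, A, η, C₁, Λ, c₂, C₂, hA, hη, hΛ, H⟩ := hY a θ ha hθ
  -- constants, all fixed before `σ`
  have hΛ0 : 0 < Λ := one_pos.trans_le hΛ
  obtain ⟨D, hD0, hD1⟩ : ∃ D : ℝ, 0 < D ∧ |C₁| ≤ D := ⟨|C₁| + 1, by positivity, by linarith⟩
  obtain ⟨lam, hlam0, hηlam⟩ : ∃ lam : ℝ, 0 ≤ lam ∧ η * lam = |c₂| + 16 * D * Λ + 1 :=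
    ⟨(|c₂| + 16 * D * Λ + 1) / η, div_nonneg (by positivity) hη.le, by field_simp⟩
  refine ⟨min σ₁ (min 1 (1 / (32 * D))), lt_min hσ₁ (lt_min one_pos (by positivity)), A, lam, 1,
    4 * |C₂|, hA, one_pos, ?_⟩
  intro K hK σ hσ hσlt Φ
  have hσσ₁ : σ < σ₁ := lt_of_lt_of_le hσlt (min_le_left _ _)
  have hσ1 : σ ≤ 1 := (lt_of_lt_of_le hσlt ((min_le_right _ _).trans (min_le_left _ _))).le
  have hσD : σ ≤ 1 / (32 * D) :=
    (lt_of_lt_of_le hσlt ((min_le_right _ _).trans (min_le_right _ _))).le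
  have hx : 8 * D * σ ^ 3 ≤ 1 / 4 := by
    have h3 : σ ^ 3 ≤ σ := pow_le_of_le_one hσ.le hσ1 (by norm_num)
    have h4 : σ * (32 * D) ≤ 1 := by rwa [le_div_iff₀ (by positivity)] at hσD
    nlinarith [mul_le_mul_of_nonneg_left h3 (by positivity : (0 : ℝ) ≤ 8 * D)]
  have hx0 : 0 ≤ 8 * D * σ ^ 3 := by positivity
  filter_upwards [H K hK σ hσ hσσ₁ Φ] with N hN p M hM hMK
  -- units: `ε = σ ν`, `W = M ν / (σ² √θ)`, mesh `Δ = ε / (Λ √θ)`, `m = ⌊W / Δ⌋ = ⌊Λ M / σ³⌋`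
  have hε : 0 < hsDiameter σ N := hsDiameter_pos hσ N
  have hsq : 0 < Real.sqrt θ := Real.sqrt_pos.2 hθ
  have hM0 : 0 ≤ M := by linarith
  have hy0 : 0 ≤ lam * M := mul_nonneg hlam0 hM0
  have hgood0 : localGibbsLaw σ (fun _ => a) (fun _ => 0) (fun _ => θ) N (Φ N) (Φ N).goodᶜ = 0 :=
    withDensity_absolutelyContinuous _ _ (Φ N).measure_compl_good
  set ν : ℝ := ((N + 1 : ℕ) : ℝ) ^ (-(1 / 3 : ℝ)) with hν
  have hνpos : 0 < ν := Real.rpow_pos_of_pos (by positivity) _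
  have hεν : hsDiameter σ N = σ * ν := rfl
  set W : ℝ := M * (ν / σ ^ 2 / Real.sqrt θ) with hW
  set Δ : ℝ := hsDiameter σ N / (Λ * Real.sqrt θ) with hΔdef
  have hΔ : 0 < Δ := div_pos hε (mul_pos hΛ0 hsq)
  have hΔle : Δ ≤ hsDiameter σ N / Real.sqrt θ := by
    rw [hΔdef, mul_comm, ← div_div]; exact div_le_self (div_nonneg hε.le hsq.le) hΛ
  have hΛΔ : Λ * Real.sqrt θ * Δ = hsDiameter σ N := by rw [hΔdef]; field_simp
  have hWΔ : W / Δ = Λ * M / σ ^ 3 := by rw [hW, hΔdef, hεν]; field_simp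
  set m : ℕ := ⌊W / Δ⌋₊ with hm
  have hmle : (m : ℝ) ≤ Λ * M / σ ^ 3 := by
    rw [hm, ← hWΔ]; exact Nat.floor_le (div_nonneg (by positivity) hΔ.le)
  set P := localGibbsLaw σ (fun _ => a) (fun _ => 0) (fun _ => θ) N (Φ N) with hP
  -- the real per-necklace bound `R k = |C₂| (D (2ε)³)ᵏ e^{c₂ M} e^{-η λ M}` dominates `Y″`'s bound
  obtain ⟨R, hR⟩ : ∃ R : ℕ → ℝ, ∀ k, R k = |C₂| * (D * (2 * hsDiameter σ N) ^ 3) ^ k *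
      Real.exp (c₂ * M) * Real.exp (-η * (lam * M)) := ⟨_, fun _ => rfl⟩
  have hYR : ∀ k : ℕ, C₂ * (C₁ * (hsDiameter σ N + Λ * Real.sqrt θ * Δ) ^ 3) ^ k *
      Real.exp (c₂ * M) * Real.exp (-η * (lam * M)) ≤ R k := by
    intro k
    rw [hΛΔ, ← two_mul, hR]
    have h1 : |(C₁ * (2 * hsDiameter σ N) ^ 3) ^ k| ≤ (D * (2 * hsDiameter σ N) ^ 3) ^ k := by
      rw [abs_pow, abs_mul, abs_of_nonneg (by positivity : (0 : ℝ) ≤ (2 * hsDiameter σ N) ^ 3)]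
      exact pow_le_pow_left₀ (by positivity) (mul_le_mul_of_nonneg_right hD1 (by positivity)) k
    have h2 : C₂ * (C₁ * (2 * hsDiameter σ N) ^ 3) ^ k ≤
        |C₂| * (D * (2 * hsDiameter σ N) ^ 3) ^ k :=
      (le_abs_self _).trans (by rw [abs_mul]; exact mul_le_mul_of_nonneg_left h1 (abs_nonneg _))
    exact mul_le_mul_of_nonneg_right (mul_le_mul_of_nonneg_right h2 (Real.exp_pos _).le)
      (Real.exp_pos _).le
  -- the slab-contact necklace events with the hot functional, indexed by `k`, the labels and the
  -- slab map
  obtain ⟨B, hB⟩ : ∃ B : (k : ℕ) → (Fin (k + 1) → Fin (N + 1)) → (Fin k → Fin (m + 1)) →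
      Set (Config (N + 1) (Fin 3) T3), ∀ k q s, B k q s =
        {z | ∃ T' : Fin (k + 2) → ℝ, Monotone T' ∧ T' 0 = 0 ∧ T' (Fin.last (k + 1)) = W ∧
          (∀ m' : Fin k, T' (Fin.castSucc (Fin.succ m')) = ((s m' : ℕ) : ℝ) * Δ) ∧
          ((∀ m' : Fin k, ∃ u ∈ Set.Icc (T' (Fin.castSucc (Fin.succ m')))
              (T' (Fin.castSucc (Fin.succ m')) + Δ),
            s(q (Fin.castSucc m'), q (Fin.succ m')) ∈
              contactPairSet (Torus.geometry (Fin 3)) (hsDiameter σ N) ((Φ N).flow u z)) ∧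
            lam * M * (ν / σ ^ 2) <
              ∑ m' : Fin (k + 1), ∫ u in T' (Fin.castSucc m')..(T' (Fin.succ m') + Δ),
                (if A * Real.sqrt θ < ‖(((Φ N).flow u z) (q m')).2‖ then
                  ‖(((Φ N).flow u z) (q m')).2‖ else 0))} := ⟨_, fun _ _ _ => rfl⟩
  -- `Y″` bounds each slab-contact necklace event of an injective label sequence
  have hper : ∀ (k : ℕ) (q : Fin (k + 1) → Fin (N + 1)), Function.Injective q →
      ∀ s : Fin k → Fin (m + 1), P (B k q s) ≤ ENNReal.ofReal (R k) := by
    intro k q hinj s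
    by_cases hex : ∃ T' : Fin (k + 2) → ℝ, Monotone T' ∧ T' 0 = 0 ∧ T' (Fin.last (k + 1)) = W ∧
        ∀ m' : Fin k, T' (Fin.castSucc (Fin.succ m')) = ((s m' : ℕ) : ℝ) * Δ
    · obtain ⟨T₀, hT₀m, hT₀0, hT₀W, hT₀s⟩ := hex
      refine (measure_mono ?_).trans
        ((hN M hM hMK Δ hΔ hΔle k q T₀ hinj hT₀m hT₀0 hT₀W (lam * M) hy0).trans
          (ENNReal.ofReal_le_ofReal (hYR k)))
      intro z hz
      rw [hB] at hz
      obtain ⟨T', -, hT'0, hT'W, hT's, hz⟩ := hz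
      have heq : T' = T₀ :=
        slabTimes_eq_of_eq (hT'0.trans hT₀0.symm) (hT'W.trans hT₀W.symm)
          fun m' => (hT's m').trans (hT₀s m').symm
      rw [heq] at hz
      exact hz
    · refine Eq.trans_le (measure_mono_null (fun z hz => ?_) measure_empty) zero_le
      rw [hB] at hz
      exact (hex (let ⟨T', h1, h2, h3, h4, _⟩ := hz; ⟨T', h1, h2, h3, h4⟩)).elim
  -- monotone slab maps and injective label sequences ending at `p`
  obtain ⟨S, hS⟩ : ∃ S : (k : ℕ) → Finset (Fin k → Fin (m + 1)), ∀ k,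
      S k = Finset.univ.filter Monotone := ⟨_, fun _ => rfl⟩
  obtain ⟨Q, hQ⟩ : ∃ Q : (k : ℕ) → Finset (Fin (k + 1) → Fin (N + 1)), ∀ k,
      Q k = Finset.univ.filter fun q => q (Fin.last k) = p ∧ Function.Injective q :=
    ⟨_, fun _ => rfl⟩
  have hScard : ∀ k, (S k).card ≤ (m + k).choose k := fun k => by
    simpa only [hS] using card_filter_monotone_le_choose k m
  have hQcard : ∀ k, (Q k).card ≤ (N + 1) ^ k := by
    intro k
    rw [hQ]
    have h := Finset.card_le_card_of_injOn
      (s := Finset.univ.filter fun q : Fin (k + 1) → Fin (N + 1) =>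
        q (Fin.last k) = p ∧ Function.Injective q)
      (t := (Finset.univ : Finset (Fin k → Fin (N + 1)))) Fin.init
      (fun _ _ => Finset.mem_coe.2 (Finset.mem_univ _)) ?_
    · rwa [Finset.card_univ, Fintype.card_fun, Fintype.card_fin, Fintype.card_fin] at h
    · intro q₁ hq₁ q₂ hq₂ h
      rw [← Fin.snoc_init_self q₁, ← Fin.snoc_init_self q₂, h,
        (Finset.mem_filter.1 (Finset.mem_coe.1 hq₁)).2.1,
        (Finset.mem_filter.1 (Finset.mem_coe.1 hq₂)).2.1]
  -- the dominating sequence `g k = |C₂| e^{c₂M - ηλM + 16DΛM} (3/4)ᵏ`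
  obtain ⟨g, hgfun⟩ : ∃ g : ℕ → ℝ, g = fun k =>
      |C₂| * Real.exp (c₂ * M + -η * (lam * M) + 16 * D * Λ * M) * (3 / 4 : ℝ) ^ k := ⟨_, rfl⟩
  have hg0 : ∀ k, 0 ≤ g k := fun k => by simp only [hgfun]; positivity
  have hgsum : Summable g := by
    rw [hgfun]; exact (summable_geometric_of_lt_one (by norm_num) (by norm_num)).mul_left _
  -- ARITHMETIC: `(N+1)ᵏ C(m+k,k) R k ≤ g k`
  have hσ3 : ((N + 1 : ℕ) : ℝ) * hsDiameter σ N ^ 3 = σ ^ 3 := succ_mul_hsDiameter_pow_three σ N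
  have harith : ∀ k : ℕ,
      (((N + 1) ^ k : ℕ) : ℝ) * ((((m + k).choose k : ℕ) : ℝ) * R k) ≤ g k := by
    intro k
    have hNR : (((N + 1) ^ k : ℕ) : ℝ) * (D * (2 * hsDiameter σ N) ^ 3) ^ k =
        (8 * D * σ ^ 3) ^ k := by
      rw [Nat.cast_pow, ← mul_pow, ← hσ3]
      ring
    have h1 : σ ^ 3 * (m : ℝ) ≤ Λ * M :=
      (mul_le_mul_of_nonneg_left hmle (by positivity)).trans_eq (by field_simp)
    have hmain : (((m + k).choose k : ℕ) : ℝ) *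
        ((((N + 1) ^ k : ℕ) : ℝ) * (D * (2 * hsDiameter σ N) ^ 3) ^ k) ≤
        Real.exp (16 * D * Λ * M) * (3 / 4) ^ k := by
      rw [hNR]
      refine (choose_mul_pow_le_exp_mul_pow hx0 hx m k).trans
        (mul_le_mul_of_nonneg_right (Real.exp_le_exp.2 ?_) (by positivity))
      nlinarith [h1, hD0]
    simp only [hR, hgfun, Real.exp_add]
    calc _ = |C₂| * Real.exp (c₂ * M) * Real.exp (-η * (lam * M)) *
            ((((m + k).choose k : ℕ) : ℝ) *
              ((((N + 1) ^ k : ℕ) : ℝ) * (D * (2 * hsDiameter σ N) ^ 3) ^ k)) := by ring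
      _ ≤ |C₂| * Real.exp (c₂ * M) * Real.exp (-η * (lam * M)) *
            (Real.exp (16 * D * Λ * M) * (3 / 4) ^ k) :=
          mul_le_mul_of_nonneg_left hmain (by positivity)
      _ = _ := by ring
  -- UNION BOUND per number of links, over the label sequences and the slab maps
  have hk : ∀ k : ℕ, P (⋃ q ∈ Q k, ⋃ s ∈ S k, B k q s) ≤ ENNReal.ofReal (g k) := by
    intro k
    calc P (⋃ q ∈ Q k, ⋃ s ∈ S k, B k q s)
        ≤ ∑ q ∈ Q k, P (⋃ s ∈ S k, B k q s) := measure_biUnion_finset_le _ _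
      _ ≤ ∑ q ∈ Q k, ∑ s ∈ S k, P (B k q s) :=
          Finset.sum_le_sum fun q _ => measure_biUnion_finset_le _ _
      _ ≤ ∑ q ∈ Q k, ∑ s ∈ S k, ENNReal.ofReal (R k) := by
          refine Finset.sum_le_sum fun q hq => Finset.sum_le_sum fun s _ => hper k q ?_ s
          rw [hQ] at hq
          exact (Finset.mem_filter.1 hq).2.2
      _ = ((Q k).card : ℝ≥0∞) * (((S k).card : ℝ≥0∞) * ENNReal.ofReal (R k)) := by
          rw [Finset.sum_const, Finset.sum_const, nsmul_eq_mul, nsmul_eq_mul]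
      _ ≤ (((N + 1) ^ k : ℕ) : ℝ≥0∞) * ((((m + k).choose k : ℕ) : ℝ≥0∞) * ENNReal.ofReal (R k)) :=
          mul_le_mul' (by exact_mod_cast hQcard k) (mul_le_mul' (by exact_mod_cast hScard k) le_rfl)
      _ = ENNReal.ofReal ((((N + 1) ^ k : ℕ) : ℝ) * ((((m + k).choose k : ℕ) : ℝ) * R k)) := by
          rw [ENNReal.ofReal_mul (by positivity), ENNReal.ofReal_mul (by positivity),
            ENNReal.ofReal_natCast, ENNReal.ofReal_natCast]
      _ ≤ ENNReal.ofReal (g k) := ENNReal.ofReal_le_ofReal (harith k)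
  -- SLABBING: off a null set the hot event is covered by the slab necklace events (sandwich)
  rw [← measure_inter_conull hgood0]
  refine (measure_mono (t := ⋃ k : ℕ, ⋃ q ∈ Q k, ⋃ s ∈ S k, B k q s) ?_).trans ?_
  · rintro z ⟨⟨k, q, T, hqk, hinj, hTm, -, hT0, hTW, hlink, hhot⟩, hz⟩
    have hz' : z ∈ (Φ N).good := hz
    -- SLABBING with the sandwich: the true link time lies in its slab and is the witness
    obtain ⟨s, T', hs, hT'm, hT'0, hT'W, hT's, hTT', -⟩ :=
      exists_slabMap_necklace_sandwich_of_chain (Φ N) hz' hΔ q T hTm hT0 hTW hlink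
    refine Set.mem_iUnion.2 ⟨k, Set.mem_iUnion₂.2 ⟨q, ?_, Set.mem_iUnion₂.2 ⟨s, ?_, ?_⟩⟩⟩
    · rw [hQ]
      exact Finset.mem_filter.2 ⟨Finset.mem_univ _, hqk, hinj⟩
    · rw [hS]
      exact Finset.mem_filter.2 ⟨Finset.mem_univ _, hs⟩
    · rw [hB]
      refine ⟨T', hT'm, hT'0, hT'W, hT's, fun m' =>
          ⟨T (Fin.castSucc (Fin.succ m')), ⟨(hTT' _).1, (hTT' _).2⟩, hlink m'⟩,
        lt_of_lt_of_le hhot (Finset.sum_le_sum fun m' _ => ?_)⟩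
      exact integral_hot_mono_interval (Φ N) hz' (q m') _ (hTT' _).1
        (hTm (Fin.castSucc_lt_succ).le) (hTT' _).2
  -- ASSEMBLING: countable union over `k`, geometric series, exponent bookkeeping
  refine (measure_iUnion_le _).trans ((ENNReal.tsum_le_tsum hk).trans ?_)
  rw [← ENNReal.ofReal_tsum_of_nonneg hg0 hgsum]
  refine ENNReal.ofReal_le_ofReal ?_
  rw [hgfun, tsum_mul_left, tsum_geometric_of_lt_one (by norm_num) (by norm_num)]
  have hexp : Real.exp (c₂ * M + -η * (lam * M) + 16 * D * Λ * M) ≤ Real.exp (-1 * M) := by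
    refine Real.exp_le_exp.2 ?_
    have h1 : c₂ * M ≤ |c₂| * M := mul_le_mul_of_nonneg_right (le_abs_self _) hM0
    have h2 : -η * (lam * M) = -(η * lam) * M := by ring
    rw [h2, hηlam]
    linarith
  calc |C₂| * Real.exp (c₂ * M + -η * (lam * M) + 16 * D * Λ * M) * (1 - 3 / 4)⁻¹
      = 4 * |C₂| * Real.exp (c₂ * M + -η * (lam * M) + 16 * D * Λ * M) := by ring
    _ ≤ 4 * |C₂| * Real.exp (-1 * M) := mul_le_mul_of_nonneg_left hexp (by positivity)

end Summit.AtomisticToContinuum.HydrodynamicLimit.Theorems.LogWindowTaggedTail
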